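import Summits.AtomisticToContinuum.Crystallization.Theses.GappedShellCensus
import Summits.AtomisticToContinuum.Crystallization.Theorems.GappedShellCensusShellCensusRefutation
import Summits.AtomisticToContinuum.Crystallization.Theorems.RadialDefectsVanish.Negative.FalseWithoutGS

/-!
# `CleanLimitExtraction` (stmt-AtomisticToContinuum-15933), negative side: the conclusion is not free

Load-bearing analysis of the bridge crux
`CleanLimitExtraction := RadialDefectsVanish → ShellCensus → FiveFoldRationing → CleanLocalLimit`
(route `GappedShellCensus`), disprover seat refuter-cdisprove-stmt-AtomisticToContinuum-15933-0:

* `CleanLocalLimitFor x` — the conclusion of `CleanLocalLimit` for ONE sequence `x` (body verbatim),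
  with `cleanLocalLimit_iff`, `cleanLimitExtraction_iff` (`Iff.rfl` readings of the route decls);
* `not_cleanLocalLimitFor_dilatedLine` — the dilated line `x N i = 2i·e₀`
  (`RadialDefectsVanish.Negative.dilatedLine`, already the tree's witness that the radial conclusion
  is not free) has NO clean local limit: a clean `Y ∋ 0` has two shell neighbours `w₁ ≠ w₂` of `0`
  in the ball of radius `1.02a ≤ 51/50`, pairwise `≥ 0.98a ≥ 0.92` apart; `1/10`-matching `0, w₁, w₂`
  to particles of a translate of the line gives three particles with pairwise distances in
  `(0.72, 2.24) ∩ 2ℕ = {2}`, i.e. three naturals pairwise differing by exactly one — absurd;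
* `cleanLocalLimit_false_without_GS : ¬ CleanLocalLimitWithoutGS` — hence the bridge cannot be
  closed from the conclusion side: dropping every hypothesis on `x` (ground-state minimality, fed in
  through `RadialDefectsVanish`) makes the conclusion false.  (The crux itself is true ex falso,
  `ShellCensus` being refuted by `Theorems/ShellCensus/Negative/TornIcosahedron.lean`; this file
  records what any NON-vacuous proof of the repaired bridge must use.)

No route item is concluded positively here.
-/

namespace Summit.AtomisticToContinuum.Crystallization.Theses.GappedShellCensus
/-- **Record of the dropped route item `CleanLimitExtraction`** = stmt-AtomisticToContinuum-15933 (ledger signature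
verbatim; NOT a route item): route GappedShellCensus rev 5 (2026-08-17T00:19Z) closed the bridge crux `moot` and dropped
it together with the refuted `ShellCensus` (superseded by `CleanLimitExtractionR` over `FiveFoldRationingR`). The
declaration `Summit.AtomisticToContinuum.Crystallization.Theses.GappedShellCensus.CleanLimitExtraction` therefore no
longer exists in the route file and this accepted module stopped elaborating (stale olean; buildfix lane 2026-08-19).
Re-created here under its original name — `ShellCensus` being the record re-created likewise in
`Theorems/GappedShellCensusShellCensusRefutation.lean`, now imported — so the result keeps building; the statement of
every previously accepted declaration in this file is unchanged. -/
def CleanLimitExtraction : Prop :=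
  RadialDefectsVanish → ShellCensus → FiveFoldRationing → CleanLocalLimit
end Summit.AtomisticToContinuum.Crystallization.Theses.GappedShellCensus

noncomputable section

open Literature.MathematicalPhysics.StatisticalMechanics

namespace Summit.AtomisticToContinuum.Crystallization.Theorems.CleanLimitExtraction.Negative

open Summit.AtomisticToContinuum.Crystallization.Theses.GappedShellCensus
open Summit.AtomisticToContinuum.Crystallization.Theorems
open Filter

/-- The conclusion of `CleanLocalLimit` for one sequence of configurations `x` (body copied
verbatim from the route decl `GappedShellCensus.CleanLocalLimit`). -/
def CleanLocalLimitFor (x : (N : ℕ) → (Fin N → EuclideanSpace ℝ (Fin 3))) : Prop :=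
  ∃ (Y : Set (EuclideanSpace ℝ (Fin 3))) (a : ℝ), 47 / 50 ≤ a ∧ a ≤ 1 ∧ (0 : EuclideanSpace ℝ (Fin 3)) ∈ Y ∧ (∃ (φ : ℕ → ℕ) (t : ℕ → EuclideanSpace ℝ (Fin 3)), StrictMono φ ∧ ∀ R ε : ℝ, 0 < ε → ∀ᶠ n in Filter.atTop, (∀ y ∈ Y, ‖y‖ ≤ R → ∃ i : Fin (φ n), dist (x (φ n) i + t n) y ≤ ε) ∧ (∀ i : Fin (φ n), ‖x (φ n) i + t n‖ ≤ R → ∃ y ∈ Y, dist (x (φ n) i + t n) y ≤ ε)) ∧ ∀ y ∈ Y, ({w ∈ Y | w ≠ y ∧ dist y w ≤ a * (1 + 1 / 50)}.ncard = 12 ∧ ∀ w ∈ Y, w ≠ y → a * (1 - 1 / 50) ≤ dist y w ∧ (dist y w ≤ a * (1 + 1 / 50) ∨ a * (63 / 50) ≤ dist y w)) ∧ ∃ T : Finset (EuclideanSpace ℝ (Fin 3)), (↑T : Set (EuclideanSpace ℝ (Fin 3))) = (fun w => a⁻¹ • (w - y)) '' {w ∈ Y | w ≠ y ∧ dist y w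 ≤ a * (1 + 1 / 50)} ∧ (Literature.Geometry.DiscreteGeometry.ShellCloseTo (1 / 5) T Literature.Geometry.DiscreteGeometry.fccKissingPattern ∨ Literature.Geometry.DiscreteGeometry.ShellCloseTo (1 / 5) T Literature.Geometry.DiscreteGeometry.hcpKissingPattern)

/-- `CleanLocalLimit` is, definitionally, "ground states ⟹ `CleanLocalLimitFor`". -/
theorem cleanLocalLimit_iff :
    CleanLocalLimit ↔ ∀ x : (N : ℕ) → (Fin N → EuclideanSpace ℝ (Fin 3)),
      (∀ N, IsGroundState lennardJones (x N)) → CleanLocalLimitFor x :=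
  Iff.rfl

/-- The crux in schematic form (definitional). -/
theorem cleanLimitExtraction_iff :
    CleanLimitExtraction ↔ (RadialDefectsVanish → ShellCensus → FiveFoldRationing →
      ∀ x : (N : ℕ) → (Fin N → EuclideanSpace ℝ (Fin 3)),
        (∀ N, IsGroundState lennardJones (x N)) → CleanLocalLimitFor x) :=
  Iff.rfl

/-- Integer step lemma: if `2|i - j| ∈ (0.7, 2.3)` for naturals `i, j`, then `i - j = ±1`. -/
theorem int_step_of_bounds (i j : ℕ) (hlo : (0.7 : ℝ) < 2 * |(i : ℝ) - (j : ℝ)|)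
    (hhi : 2 * |(i : ℝ) - (j : ℝ)| < 2.3) :
    (i : ℤ) - (j : ℤ) = 1 ∨ (i : ℤ) - (j : ℤ) = -1 := by
  have hcast : (i : ℝ) - (j : ℝ) = (((i : ℤ) - (j : ℤ) : ℤ) : ℝ) := by push_cast; ring
  rw [hcast] at hlo hhi
  generalize hm : (i : ℤ) - (j : ℤ) = m at hlo hhi
  rw [← Int.cast_abs] at hlo hhi
  have h1 : ((|m| : ℤ) : ℝ) < 2 := by linarith
  have h2 : (0 : ℝ) < ((|m| : ℤ) : ℝ) := by linarith
  have h3 : |m| < 2 := by exact_mod_cast h1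
  have h4 : 0 < |m| := by exact_mod_cast h2
  rcases abs_cases m with ⟨h, _⟩ | ⟨h, _⟩ <;> rw [h] at h3 h4 <;> omega

/-- **The dilated line has no clean local limit**: `CleanLocalLimitFor` fails for
`x N i = (2i)·e₀`. -/
theorem not_cleanLocalLimitFor_dilatedLine :
    ¬ CleanLocalLimitFor RadialDefectsVanish.Negative.dilatedLine := by
  rintro ⟨Y, a, ha1, ha2, h0, ⟨φ, t, -, hlim⟩, hgood⟩
  -- two distinct shell neighbours `w₁ ≠ w₂` of the origin
  obtain ⟨⟨hcount, hsep0⟩, -⟩ := hgood 0 h0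
  have hS0 : {w ∈ Y | w ≠ 0 ∧ dist 0 w ≤ a * (1 + 1 / 50)}.ncard ≠ 0 := by rw [hcount]; norm_num
  have hS1 : 1 < {w ∈ Y | w ≠ 0 ∧ dist 0 w ≤ a * (1 + 1 / 50)}.ncard := by rw [hcount]; norm_num
  obtain ⟨w₁, hw₁Y, hw₁0, hw₁d⟩ := Set.nonempty_of_ncard_ne_zero hS0
  obtain ⟨w₂, ⟨hw₂Y, hw₂0, hw₂d⟩, hne⟩ := Set.exists_ne_of_one_lt_ncard hS1 w₁
  have hsep01 : a * (1 - 1 / 50) ≤ dist 0 w₁ := (hsep0 w₁ hw₁Y hw₁0).1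
  have hsep02 : a * (1 - 1 / 50) ≤ dist 0 w₂ := (hsep0 w₂ hw₂Y hw₂0).1
  obtain ⟨⟨-, hsep1⟩, -⟩ := hgood w₁ hw₁Y
  have hsep12 : a * (1 - 1 / 50) ≤ dist w₁ w₂ := (hsep1 w₂ hw₂Y hne).1
  have hup12 : dist w₁ w₂ ≤ dist 0 w₁ + dist 0 w₂ := by
    calc dist w₁ w₂ ≤ dist w₁ 0 + dist 0 w₂ := dist_triangle _ _ _
      _ = dist 0 w₁ + dist 0 w₂ := by rw [dist_comm w₁ 0]
  -- matching at radius `51/50`, tolerance `1/10`, at SOME index `n`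
  obtain ⟨n, hn1, -⟩ := (hlim (51 / 50) (1 / 10) (by norm_num)).exists
  have hnorm : ∀ w : EuclideanSpace ℝ (Fin 3), dist 0 w ≤ a * (1 + 1 / 50) → ‖w‖ ≤ 51 / 50 := by
    intro w hw
    rw [← dist_zero_right, dist_comm]
    nlinarith
  obtain ⟨i₀, hi₀⟩ := hn1 0 h0 (by norm_num)
  obtain ⟨i₁, hi₁⟩ := hn1 w₁ hw₁Y (hnorm w₁ hw₁d)
  obtain ⟨i₂, hi₂⟩ := hn1 w₂ hw₂Y (hnorm w₂ hw₂d)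
  -- particle distances are `2|i - j|`
  have hpart : ∀ i j : Fin (φ n),
      dist (RadialDefectsVanish.Negative.dilatedLine (φ n) i + t n)
        (RadialDefectsVanish.Negative.dilatedLine (φ n) j + t n) = 2 * |((i : ℕ) : ℝ) - ((j : ℕ) : ℝ)| := by
    intro i j
    rw [dist_add_right, RadialDefectsVanish.Negative.dist_dilatedLine]
  -- `|dist p q - dist y z| ≤ dist p y + dist q z ≤ 2/10`
  have hkey : ∀ (p q y z : EuclideanSpace ℝ (Fin 3)), dist p y ≤ 1 / 10 → dist q z ≤ 1 / 10 →
      dist y z - 2 / 10 ≤ dist p q ∧ dist p q ≤ dist y z + 2 / 10 := by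
    intro p q y z hp hq
    have h := dist_dist_dist_le p q y z
    rw [Real.dist_eq] at h
    constructor <;> linarith [(abs_sub_le_iff.1 (h.trans (add_le_add hp hq))).1,
      (abs_sub_le_iff.1 (h.trans (add_le_add hp hq))).2]
  obtain ⟨l01, u01⟩ := hkey _ _ _ _ hi₀ hi₁
  obtain ⟨l02, u02⟩ := hkey _ _ _ _ hi₀ hi₂
  obtain ⟨l12, u12⟩ := hkey _ _ _ _ hi₁ hi₂
  rw [hpart] at l01 u01 l02 u02 l12 u12
  have s01 := int_step_of_bounds (i₀ : ℕ) (i₁ : ℕ) (by nlinarith) (by nlinarith)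
  have s02 := int_step_of_bounds (i₀ : ℕ) (i₂ : ℕ) (by nlinarith) (by nlinarith)
  have s12 := int_step_of_bounds (i₁ : ℕ) (i₂ : ℕ) (by nlinarith) (by nlinarith)
  omega

/-- `CleanLocalLimit` with the ground-state hypothesis DROPPED: the conclusion of the bridge with
every hypothesis on `x` removed. -/
def CleanLocalLimitWithoutGS : Prop :=
  ∀ x : (N : ℕ) → (Fin N → EuclideanSpace ℝ (Fin 3)), CleanLocalLimitFor x

/-- **The conclusion of the bridge is not free**: `CleanLocalLimit` without its hypothesis on `x` is
false (witness: the dilated line).  Any non-vacuous proof of `CleanLimitExtraction` must use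
`RadialDefectsVanish` on the given sequence. -/
theorem cleanLocalLimit_false_without_GS : ¬ CleanLocalLimitWithoutGS :=
  fun h => not_cleanLocalLimitFor_dilatedLine (h _)

end Summit.AtomisticToContinuum.Crystallization.Theorems.CleanLimitExtraction.Negative

end
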